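import Mathlib
import Summits.Ventures.PercRepro2.Defs
import Summits.Ventures.PercRepro2.Graph
import Summits.Ventures.PercRepro2.HullDefs
import Summits.Ventures.PercRepro2.LocRows
import Summits.Ventures.PercRepro2.SwRow
import Summits.Ventures.PercRepro2.SwGlue
import Summits.Ventures.PercRepro2.SwAllRow

/-!
# Row 2′SW-ALL across a cut vertex: the placements `c = l`, pendant, `c = h` (blind cell PercRepro2, night-4 g5,
2026-08-24; proofs/NIGHT4-BRIDGE.md §11)

The placements of night-4 g4's block reduction (NIGHT4-SIDE.md §5′) for the RIGID row `LocRows.SwAll`: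
* `swAll_glue_cut_l` — `c = l` (no hypothesis: the swap of the `h`-side);
* `swAll_glue_pendant` — the marks on the first side (2′SW-ALL(G₁) ⟹ 2′SW-ALL(G));
* `swAll_glue_cut_h` — `c = h`, `l, o` on the first side (2′SW-ALL(G₁) ⟹ 2′SW-ALL(G));
The placements `c = o` and `o ∣ {l, h}` are in SwAllBlocks2.lean; the two placements with a mark on each
side next to `c` (`{l, o} ∣ h` and `l ∣ {h, o}`) need the rigid side injection and the rigid one-sided
domination (§11) and are not formalised.
-/

namespace Summit.Ventures.PercRepro2

namespace Glue

open Hull LocRows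

open scoped Classical

variable {V : Type*} {E₁ E₂ : Type*}
variable {ends₁ : E₁ → Sym2 V} {ends₂ : E₂ → Sym2 V} {c : V} {V₁ V₂ : Set V}

/-- An edge of the first side inside a set lies inside the set's first-side part. -/
lemma mem_within_inl_glue (hg : IsGluing ends₁ ends₂ c V₁ V₂) {S : Set V} {e : E₁}
    (he : Sum.inl e ∈ within (glue ends₁ ends₂) S) : e ∈ within ends₁ (S ∩ V₁) := by
  obtain ⟨x, hx, y, hy, hends⟩ := he
  refine ⟨x, ⟨hx, hg.mem₁ e x ?_⟩, y, ⟨hy, hg.mem₁ e y ?_⟩, hends⟩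
  · rw [show ends₁ e = s(x, y) from hends]; exact Sym2.mem_mk_left x y
  · rw [show ends₁ e = s(x, y) from hends]; exact Sym2.mem_mk_right x y

/-- An edge of the second side inside a set lies inside the set's second-side part. -/
lemma mem_within_inr_glue (hg : IsGluing ends₁ ends₂ c V₁ V₂) {S : Set V} {e : E₂}
    (he : Sum.inr e ∈ within (glue ends₁ ends₂) S) : e ∈ within ends₂ (S ∩ V₂) := by
  obtain ⟨x, hx, y, hy, hends⟩ := he
  refine ⟨x, ⟨hx, hg.mem₂ e x ?_⟩, y, ⟨hy, hg.mem₂ e y ?_⟩, hends⟩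
  · rw [show ends₂ e = s(x, y) from hends]; exact Sym2.mem_mk_left x y
  · rw [show ends₂ e = s(x, y) from hends]; exact Sym2.mem_mk_right x y

/-- The swap of the second side flips its red edges. -/
lemma swap₂_inr_apply (ζ : Config (E₁ ⊕ E₂)) (e : E₂) (h : ζ (Sum.inr e) = true) :
    swap₂ ζ (Sum.inr e) = false := by
  show blue (ζ ∘ Sum.inr) e = false
  rw [blue_apply]; have : (ζ ∘ Sum.inr) e = true := h; rw [this]; rfl

variable [Fintype E₁] [Fintype E₂] [DecidableEq E₁] [DecidableEq E₂]

/-- **2′SW-ALL across a cut at `l`** (`c = l`, `o` on the first side, `h` on the second): the colour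
swap of the `h`-side. -/
theorem swAll_glue_cut_l {l h o : V} (hg : IsGluing ends₁ ends₂ l V₁ V₂) (ho : o ∈ V₁) (hol : o ≠ l)
    (hh : h ∈ V₂) (hhl : h ≠ l) : SwAll (glue ends₁ ends₂) l h o := by
  have key : ∀ ζ : Config (E₁ ⊕ E₂),
      ζ ∈ tgtU (glue ends₁ ends₂) l h {S : Set V | o ∈ S} ↔
        (h ∉ cluster ends₂ (ζ ∘ Sum.inr) l ∧ h ∉ cluster ends₂ (blue (ζ ∘ Sum.inr)) l) ∧
          o ∈ cluster ends₁ (ζ ∘ Sum.inl) l ∧ o ∉ cluster ends₁ (blue (ζ ∘ Sum.inl)) l := by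
    intro ζ
    rw [mem_tgtU_glue_iff, mem_cluster_glue_iff₁ hg hg.c_mem₁ ho hol,
      mem_cluster_glue_iff₁ hg hg.c_mem₁ ho hol, mem_cluster_glue_iff₂ hg hg.c_mem₂ hh hhl,
      mem_cluster_glue_iff₂ hg hg.c_mem₂ hh hhl, blue_comp_inl, blue_comp_inr]
  refine ⟨fun x => swap₂ x.1, ?_, ?_⟩
  · intro x y hxy
    have := congrArg swap₂ hxy
    simp only [swap₂_swap₂] at this
    exact Subtype.ext this
  · intro x
    have hx := (key x.1).1 x.2
    refine ⟨(key _).2 ?_, ?_⟩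
    · rw [swap₂_inl, swap₂_inr, blue_blue]
      exact ⟨⟨hx.1.2, hx.1.1⟩, hx.2⟩
    · -- the red cluster of `h` lives on the second side: its red edges are swapped
      intro e he hred
      rcases e with e₁ | e₂
      · exfalso
        obtain ⟨a, ⟨ha, haV₁⟩, _, _, _⟩ := mem_within_inl_glue hg he
        rw [cluster_glue_eq₂ hg hh] at ha
        rcases ha with ha | ⟨hl, _⟩
        · have haV₂ : a ∈ V₂ := cluster_subset_of_mem₂ hg hh ha
          have hal : a = l := hg.inter a haV₁ haV₂
          rw [hal] at ha
          exact hx.1.1 (mem_cluster_comm.1 ha)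
        · exact hx.1.1 (mem_cluster_comm.1 hl)
      · exact swap₂_inr_apply x.1 e₂ hred

/-- **2′SW-ALL with a pendant side**: `l, h, o` on the first side, the second side attached at `c`. -/
theorem swAll_glue_pendant {l h o : V} (hg : IsGluing ends₁ ends₂ c V₁ V₂) (hl : l ∈ V₁)
    (hh : h ∈ V₁) (hhc : h ≠ c) (ho : o ∈ V₁) (hoc : o ≠ c) (h₁ : SwAll ends₁ l h o) :
    SwAll (glue ends₁ ends₂) l h o := by
  obtain ⟨f₁, hf₁, hmem₁⟩ := h₁
  have key : ∀ ζ : Config (E₁ ⊕ E₂),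
      ζ ∈ tgtU (glue ends₁ ends₂) l h {S : Set V | o ∈ S} ↔
        ζ ∘ Sum.inl ∈ tgtU ends₁ l h {S : Set V | o ∈ S} := by
    intro ζ
    rw [mem_tgtU_glue_iff, mem_cluster_glue_iff₁ hg hl hh hhc, mem_cluster_glue_iff₁ hg hl hh hhc,
      mem_cluster_glue_iff₁ hg hl ho hoc, mem_cluster_glue_iff₁ hg hl ho hoc, blue_comp_inl]
    simp only [tgtU, Finset.mem_filter, Finset.mem_univ, true_and, mem_hull_iff, Set.mem_setOf_eq,
      not_or]
  refine ⟨fun x => pair (f₁ ⟨x.1 ∘ Sum.inl, (key _).1 x.2⟩) (blue (x.1 ∘ Sum.inr)), ?_, ?_⟩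
  · intro x y hxy
    have h1 := congrArg (fun ζ => ζ ∘ Sum.inl) hxy
    have h2 := congrArg (fun ζ => ζ ∘ Sum.inr) hxy
    simp only [pair_inl, pair_inr] at h1 h2
    have h1' : x.1 ∘ Sum.inl = y.1 ∘ Sum.inl := congrArg Subtype.val (hf₁ h1)
    have h2' : x.1 ∘ Sum.inr = y.1 ∘ Sum.inr := by
      have := congrArg blue h2
      simpa only [blue_blue] using this
    apply Subtype.ext
    rw [← pair_comp x.1, ← pair_comp y.1, h1', h2']
  · intro x
    obtain ⟨ht, hflip⟩ := hmem₁ ⟨x.1 ∘ Sum.inl, (key _).1 x.2⟩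
    refine ⟨(key _).2 (by rw [pair_inl]; exact ht), ?_⟩
    intro e he hred
    rcases e with e₁ | e₂
    · -- a first-side edge inside the red cluster of `h` is inside its first-side cluster
      have hw : e₁ ∈ within ends₁ (cluster ends₁ (x.1 ∘ Sum.inl) h) := by
        obtain ⟨a, ⟨ha, haV₁⟩, b, ⟨hb, hbV₁⟩, hends⟩ := mem_within_inl_glue hg he
        refine ⟨a, ?_, b, ?_, hends⟩
        · rw [cluster_glue_eq hg hh] at ha
          rcases ha with ha | ⟨hc, ha₂⟩
          · exact ha
          · have haV₂ : a ∈ V₂ := cluster_subset_of_mem₂ hg hg.c_mem₂ ha₂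
            rw [hg.inter a haV₁ haV₂]; exact hc
        · rw [cluster_glue_eq hg hh] at hb
          rcases hb with hb | ⟨hc, hb₂⟩
          · exact hb
          · have hbV₂ : b ∈ V₂ := cluster_subset_of_mem₂ hg hg.c_mem₂ hb₂
            rw [hg.inter b hbV₁ hbV₂]; exact hc
      show f₁ ⟨x.1 ∘ Sum.inl, (key _).1 x.2⟩ e₁ = false
      exact hflip e₁ hw hred
    · show blue (x.1 ∘ Sum.inr) e₂ = false
      rw [blue_apply]; have : (x.1 ∘ Sum.inr) e₂ = true := hred; rw [this]; rfl

/-- **2′SW-ALL across a cut at `h`** (`c = h`, `l, o` on the first side). -/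
theorem swAll_glue_cut_h {l h o : V} (hg : IsGluing ends₁ ends₂ h V₁ V₂) (hl : l ∈ V₁) (ho : o ∈ V₁)
    (hoh : o ≠ h) (h₁ : SwAll ends₁ l h o) : SwAll (glue ends₁ ends₂) l h o := by
  obtain ⟨f₁, hf₁, hmem₁⟩ := h₁
  have hmem_h : ∀ ζ : Config (E₁ ⊕ E₂),
      h ∈ cluster (glue ends₁ ends₂) ζ l ↔ h ∈ cluster ends₁ (ζ ∘ Sum.inl) l := by
    intro ζ
    rw [cluster_glue_eq hg hl]
    simp only [Set.mem_union, Set.mem_setOf_eq]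
    constructor
    · rintro (h' | ⟨h', _⟩) <;> exact h'
    · exact Or.inl
  have key : ∀ ζ : Config (E₁ ⊕ E₂),
      ζ ∈ tgtU (glue ends₁ ends₂) l h {S : Set V | o ∈ S} ↔
        ζ ∘ Sum.inl ∈ tgtU ends₁ l h {S : Set V | o ∈ S} := by
    intro ζ
    rw [mem_tgtU_glue_iff, hmem_h, hmem_h, mem_cluster_glue_iff₁ hg hl ho hoh,
      mem_cluster_glue_iff₁ hg hl ho hoh, blue_comp_inl]
    simp only [tgtU, Finset.mem_filter, Finset.mem_univ, true_and, mem_hull_iff, Set.mem_setOf_eq,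
      not_or]
  refine ⟨fun x => pair (f₁ ⟨x.1 ∘ Sum.inl, (key _).1 x.2⟩) (blue (x.1 ∘ Sum.inr)), ?_, ?_⟩
  · intro x y hxy
    have h1 := congrArg (fun ζ => ζ ∘ Sum.inl) hxy
    have h2 := congrArg (fun ζ => ζ ∘ Sum.inr) hxy
    simp only [pair_inl, pair_inr] at h1 h2
    have h1' : x.1 ∘ Sum.inl = y.1 ∘ Sum.inl := congrArg Subtype.val (hf₁ h1)
    have h2' : x.1 ∘ Sum.inr = y.1 ∘ Sum.inr := by
      have := congrArg blue h2
      simpa only [blue_blue] using this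
    apply Subtype.ext
    rw [← pair_comp x.1, ← pair_comp y.1, h1', h2']
  · intro x
    obtain ⟨ht, hflip⟩ := hmem₁ ⟨x.1 ∘ Sum.inl, (key _).1 x.2⟩
    refine ⟨(key _).2 (by rw [pair_inl]; exact ht), ?_⟩
    intro e he hred
    rcases e with e₁ | e₂
    · have hw : e₁ ∈ within ends₁ (cluster ends₁ (x.1 ∘ Sum.inl) h) := by
        obtain ⟨a, ⟨ha, haV₁⟩, b, ⟨hb, hbV₁⟩, hends⟩ := mem_within_inl_glue hg he
        refine ⟨a, ?_, b, ?_, hends⟩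
        · rw [cluster_glue_c hg] at ha
          rcases ha with ha | ha₂
          · exact ha
          · have haV₂ : a ∈ V₂ := cluster_subset_of_mem₂ hg hg.c_mem₂ ha₂
            rw [hg.inter a haV₁ haV₂]; exact mem_cluster_self _ _ _
        · rw [cluster_glue_c hg] at hb
          rcases hb with hb | hb₂
          · exact hb
          · have hbV₂ : b ∈ V₂ := cluster_subset_of_mem₂ hg hg.c_mem₂ hb₂
            rw [hg.inter b hbV₁ hbV₂]; exact mem_cluster_self _ _ _
      show f₁ ⟨x.1 ∘ Sum.inl, (key _).1 x.2⟩ e₁ = false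
      exact hflip e₁ hw hred
    · show blue (x.1 ∘ Sum.inr) e₂ = false
      rw [blue_apply]; have : (x.1 ∘ Sum.inr) e₂ = true := hred; rw [this]; rfl

end Glue

end Summit.Ventures.PercRepro2
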